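import Literature.Computability.Complexity.ProbabilisticClasses
import Literature.Computability.MetaComplexity.DistProblems
import HarnessLib

-- provenance: harness21/H21/H21/Prelude/CplxMeta/HeuristicClasses.lean @ 2415787 (interim HEAD d8f2665); M5 mechanical rewrite
/-!
# Complexity meta: randomized heuristic classes, distributional reductions, completeness

Trunk `CplxMeta` (G14), concept C12 (`HeuristicClasses`; realises the randomized part of the
notion `distributional_problems_avgP`; outline C12 / D4). Builds on `DistProblems.lean` (C11).

We define

* the randomized average-case classes `AvgBPP` (randomized errorless heuristic schemes),
  `HeurBPP` (randomized heuristic schemes) and `HeurDeltaBPP δ` (randomized heuristic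
  algorithms with failure probability `δ`);
* domination of ensembles along a parametrised map, `IsDominatedVia D₁ f D₂`, and the
  (deterministic, heuristic) polynomial-time reductions between distributional problems
  `DistProblem.PolyTimeReducible Q₁ Q₂` of Levin / Bogdanov–Trevisan;
* hardness and completeness for `DistNP`: `IsDistHard`, `IsDistNPComplete`;
* the API: trivial inclusions `AvgP ⊆ AvgBPP`, `HeurP ⊆ HeurBPP`, `AvgBPP ⊆ HeurBPP`,
  `(BPP, 𝒟) ⊆ HeurBPP`; reflexivity/transitivity of reductions; closure of `AvgP` and
  `HeurBPP` under reductions; existence of `DistNP`-complete problems (Levin 1986);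
* the machine-plumbing fact `polyTimeComputable_schemeEnc_dropParams` through which
  `(BPP, 𝒟) ⊆ HeurBPP` is reduced to `BPP` error reduction (sibling `HeuristicClassesProofs.lean`).

## Design choices

* A randomized heuristic scheme is a G01 `RandAlg (List Bool × ℕ × ℕ) β` on inputs
  `(x, 1ⁿ, 1ᵐ)` encoded by `schemeEnc` (so the coin budget and the running time are measured in
  `|⟨x, 1ⁿ, 1ᵐ⟩|`; "polynomial in `n/δ`", `δ = 1/m`, exactly under `HasPolyLength`, as in C11).
* Following Bogdanov–Trevisan (Def. 2.11–2.13), an input `x` is *bad* for the scheme if the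
  algorithm misbehaves on it (outputs `⊥`, resp. errs) with probability `≥ 1/4` over its coins,
  and the class condition is `Pr_{x ∼ Dₙ}[x bad] ≤ δ`. The **inner constant `1/4` is
  amplification-robust**: replacing it by any constant in `(0, 1/2)` (or by `2^{-poly}`) gives
  the same classes, by majority vote over independent runs (BT 2006, remark after Def. 2.11).
  For `AvgBPP` the errorless requirement is the pointwise bound
  `Pr_coins[A(x) = ¬L(x)] ≤ 1/4` for every `x` **in the support of `Dₙ`** (BT Def. 2.11 (i),
  "for every `n` and every `x ∈ Supp Dₙ`"), matching C11's support-relative `IsErrorlessFor`.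
  A global (all-`x`) version would be a strictly smaller class and `AvgP ⊆ AvgBPP` would fail
  (point-mass ensembles on incompressible strings give counterexamples); the outline sketch's
  global quantifier is therefore not followed. The bound is imposed for every `m` (including
  `m = 0`), as C11's `AvgP` does (`∀ m, IsErrorlessFor …`).
* Likewise the *correctness* of a reduction (`PolyTimeReducible`) is required on `supp D₁,ₙ`
  only, verbatim as in BT Def. 3.1 (i). Since domination maps `supp D₁,ₙ` into
  `supp D₂,ₘ₍ₙ₎` (a fibre of positive `D₁,ₙ`-mass has positive `D₂,ₘ₍ₙ₎`-mass), support-relative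
  correctness composes (`PolyTimeReducible.trans`) and suffices for the closure lemmas.
* Domination and reductions are stated in `ℝ≥0∞` directly on the `PMF`s (point masses
  `D₂ (m.eval n) y` and the outer measure of the fibre `{x | f x n = y}`), avoiding `toReal`.
  The reduction may change the distributional parameter, `n ↦ m(n)`, where — literally as in
  BT Def. 3.1 (ii) — both the domination factor `p` and the parameter map `m` are *polynomials*
  (`Polynomial ℕ`). This deviates from the outline sketch (which had an arbitrary `m : ℕ → ℕ`
  bounded by `p`): with an uncomputable `m` the composition of reductions and the closure of
  `HeurBPP` under reductions would fail (the reduced algorithm must compute `m(n)` from `1ⁿ`), so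
  the polynomial form is required for `PolyTimeReducible.trans` and
  `mem_HeurBPP_of_polyTimeReducible` to be true. The map `f` itself receives `(x, 1ⁿ)` via
  `paramEnc`. Reductions are *deterministic* (BT Def. 3.1); randomized heuristic reductions
  (needed for Impagliazzo–Levin's `(NP, PSamp) ≤ (NP, U)`) are not defined here.
* `distClass_BPP_subset_HeurBPP` is stated for every ensemble (`Set.univ`), strengthening the
  outline's uniform-ensemble version, in line with C11's `distClass_P_subset_AvgP`.
* Universes: everything is over `Bool`/`List Bool` (`Type`), as in G01. Distributional problems
  are called `Q` (`Π` is a Lean token). `noncomputable` is confined to declarations mentioning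
  `Set.boolIndicator` / real probabilities.

Mathlib anchors used (not redefined): `PMF`, `PMF.toOuterMeasure`, `Polynomial.eval`,
`Set.boolIndicator`, `Computability.encodeBool`. Mathlib has no average-case classes,
distributional reductions or `DistNP`-completeness (grep: no `HeurBPP`, `AvgBPP`, `DistNP`,
`dominat` in the complexity sense). H21 anchors: `RandAlg`, `RandAlg.pr`, `RandAlg.IsPolyTime`,
`RandAlg.ofDet`, `PolyTimeComputable`, `BPP`, and C11's `Ensemble`, `DistProblem`, `DistNP`,
`distClass`, `paramEnc`, `schemeEnc`, `optBoolEnc`, `AvgP`, `HeurP`.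

## References

* A. Bogdanov, L. Trevisan, *Average-Case Complexity*, Found. Trends TCS 2 (2006), Ch. 2
  (Def. 2.11 randomized errorless heuristic schemes / `AvgBPP`, Def. 2.12–2.13 `HeurBPP`,
  `Heur_δBPP`), Ch. 3 (Def. 3.1 heuristic polynomial-time reductions, domination; Lemma 3.2
  closure; Thm. 3.3 completeness of bounded halting for `(NP, U)`-type ensembles), Ch. 5
  (samplable ensembles).
* L. Levin, *Average case complete problems*, SIAM J. Comput. 15 (1986), 285–286.
* S. Ben-David, B. Chor, O. Goldreich, M. Luby, *On the theory of average case complexity*,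
  J. Comput. Syst. Sci. 44 (1992), §3 (reductions, universal distributions, completeness).
* R. Impagliazzo, L. Levin, *No better ways to generate hard NP instances than picking uniformly
  at random*, FOCS 1990.
* R. Impagliazzo, *A personal view of average-case complexity*, CCC 1995, §2.
-/

namespace Literature.Computability.MetaComplexity

open _root_.Computability Complexity
open scoped ENNReal

/-! ### Randomized heuristic classes -/

/-- `AvgBPP`: distributional problems admitting a *randomized errorless heuristic scheme* — a
probabilistic polynomial-time algorithm `A(x, 1ⁿ, 1ᵐ) ∈ {0,1,⊥}` (time and coins polynomial in
`|⟨x, 1ⁿ, 1ᵐ⟩|`) such that (i) for every `n, m` and every `x ∈ supp Dₙ`,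
`Pr_coins[A(x,1ⁿ,1ᵐ) = ¬[x ∈ L]] ≤ 1/4` (essentially errorless **on the support**, as in the
source and as C11's `IsErrorlessFor`; off-support behaviour is unconstrained), and (ii) for
every `n` and `m > 0`, `Pr_{x ∼ Dₙ}[Pr_coins[A(x,1ⁿ,1ᵐ) = ⊥] ≥ 1/4] ≤ 1/m`. The inner constant
`1/4` is amplification-robust (any constant `< 1/2` gives the same class, by majority vote).
[Bogdanov–Trevisan 2006, Def. 2.11 and the remark following it; Impagliazzo 1995, §2] [cite: BogdanovTrevisan2006, Def. 2.11 and the remark following it] -/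
noncomputable def AvgBPP : Set DistProblem :=
  {Q | ∃ A : RandAlg (List Bool × ℕ × ℕ) (Option Bool), A.IsPolyTime schemeEnc optBoolEnc ∧
    (∀ n m : ℕ, ∀ x ∈ (Q.dist n).support,
      A.pr schemeEnc (x, n, m) {some (!(Q.lang.boolIndicator x))} ≤ 1 / 4) ∧
    ∀ n m : ℕ, 0 < m →
      Q.dist.prob n {x | 1 / 4 ≤ A.pr schemeEnc (x, n, m) {none}} ≤ 1 / m}

/-- `HeurBPP`: distributional problems admitting a *randomized heuristic scheme* — a
probabilistic polynomial-time algorithm `A(x, 1ⁿ, 1ᵐ) ∈ {0,1}` (time and coins polynomial in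
`|⟨x, 1ⁿ, 1ᵐ⟩|`) such that for every `n` and `m > 0`,
`Pr_{x ∼ Dₙ}[Pr_coins[A(x,1ⁿ,1ᵐ) ≠ [x ∈ L]] ≥ 1/4] ≤ 1/m`. The inner constant `1/4` is
amplification-robust (any constant `< 1/2` gives the same class, by majority vote).
[Bogdanov–Trevisan 2006, Def. 2.12–2.13; Impagliazzo 1995, §2] [cite: BogdanovTrevisan2006, Def. 2.12–2.13] -/
noncomputable def HeurBPP : Set DistProblem :=
  {Q | ∃ A : RandAlg (List Bool × ℕ × ℕ) Bool, A.IsPolyTime schemeEnc encodeBool ∧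
    ∀ n m : ℕ, 0 < m →
      Q.dist.prob n {x | 1 / 4 ≤ A.pr schemeEnc (x, n, m) {b | b ≠ Q.lang.boolIndicator x}} ≤
        1 / m}

/-- `HeurDeltaBPP δ` (`Heur_δ BPP`): distributional problems admitting a probabilistic
polynomial-time *heuristic algorithm* `A(x, 1ⁿ) ∈ {0,1}` (input via `paramEnc`) with
`Pr_{x ∼ Dₙ}[Pr_coins[A(x,1ⁿ) ≠ [x ∈ L]] ≥ 1/4] ≤ δ n` for every `n`. The inner constant `1/4`
is amplification-robust. As in C11's `AvgDeltaP` / `HeurDeltaP`, `δ : ℕ → ℝ` is unconstrained: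
for `δ n < 0` the condition at `n` is unsatisfiable, for `δ n ≥ 1` it is void.
[Bogdanov–Trevisan 2006, Def. 2.13] [cite: BogdanovTrevisan2006, Def. 2.13] -/
noncomputable def HeurDeltaBPP (δ : ℕ → ℝ) : Set DistProblem :=
  {Q | ∃ A : RandAlg (List Bool × ℕ) Bool, A.IsPolyTime paramEnc encodeBool ∧
    ∀ n, Q.dist.prob n {x | 1 / 4 ≤ A.pr paramEnc (x, n) {b | b ≠ Q.lang.boolIndicator x}} ≤ δ n}

/-! ### Domination and reductions -/

/-- `IsDominatedVia D₁ f D₂`: the ensemble `D₁` is *dominated* by `D₂` along the parametrised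
map `f : (x, n) ↦ f x n` — there are polynomials `p` (domination factor) and `m` (parameter map)
such that for every `n` and every string `y`,
`Pr_{x ∼ D₁,ₙ}[f(x; n) = y] ≤ p(n) · D₂,ₘ₍ₙ₎(y)` (in `ℝ≥0∞`). This is the domination condition
of a heuristic reduction: `f` does not concentrate `D₁`-typical inputs on `D₂`-rare outputs.
Both `p` and `m` are `Polynomial ℕ`, literally as in the source (in particular `m` is computable
in time polynomial in `n`, which composition and closure proofs use).
[Bogdanov–Trevisan 2006, Def. 3.1 (ii) ("domination"); Levin 1986; Impagliazzo–Levin 1990] [cite: BogdanovTrevisan2006, Def. 3.1 (ii] -/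
def IsDominatedVia (D₁ : Ensemble) (f : List Bool → ℕ → List Bool) (D₂ : Ensemble) : Prop :=
  ∃ p m : Polynomial ℕ, ∀ (n : ℕ) (y : List Bool),
    (D₁ n).toOuterMeasure {x | f x n = y} ≤ ((p.eval n : ℕ) : ℝ≥0∞) * (D₂ (m.eval n)) y

/-- `Q₁.PolyTimeReducible Q₂` (`(L₁, D₁) ≤_{AvgP} (L₂, D₂)`): there is a (deterministic)
*heuristic polynomial-time reduction* — a map `f(x; n)`, polynomial-time computable from
`⟨x, 1ⁿ⟩` (`paramEnc`), which is *correct on the support* (`f(x; n) ∈ L₂ ↔ x ∈ L₁` for every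
`n` and every `x ∈ supp D₁,ₙ`, verbatim BT Def. 3.1 (i)) and along which `D₁` is dominated by
`D₂` (`IsDominatedVia`). Domination sends `supp D₁,ₙ` into `supp D₂,ₘ₍ₙ₎`, so support-relative
correctness composes.
[Bogdanov–Trevisan 2006, Def. 3.1; Levin 1986; Impagliazzo–Levin 1990, §2] [cite: BogdanovTrevisan2006, Def. 3.1] -/
def DistProblem.PolyTimeReducible (Q₁ Q₂ : DistProblem) : Prop :=
  ∃ f : List Bool → ℕ → List Bool,
    PolyTimeComputable paramEnc (id : List Bool → List Bool) (Function.uncurry f) ∧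
    (∀ n, ∀ x ∈ (Q₁.dist n).support, f x n ∈ Q₂.lang ↔ x ∈ Q₁.lang) ∧
    IsDominatedVia Q₁.dist f Q₂.dist

/-- `IsDistHard 𝒞 Q`: the distributional problem `Q` is *hard* for the class `𝒞` of
distributional problems under heuristic polynomial-time reductions: every `Q' ∈ 𝒞` reduces to
`Q`. [Bogdanov–Trevisan 2006, §3.1 (Def. 3.1, "`DistNP`-hard"); Levin 1986] [cite: BogdanovTrevisan2006, §3.1 (Def. 3.1  " DistNP -hard"] -/
def IsDistHard (𝒞 : Set DistProblem) (Q : DistProblem) : Prop :=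
  ∀ Q' ∈ 𝒞, Q'.PolyTimeReducible Q

/-- `IsDistNPComplete Q`: `Q` is `DistNP`-complete — `Q ∈ DistNP = (NP, PSamp)` and every
problem in `DistNP` reduces to `Q` under heuristic polynomial-time reductions.
[Bogdanov–Trevisan 2006, §3.1–3.3; Levin 1986; Impagliazzo–Levin 1990] [cite: BogdanovTrevisan2006, §3.1–3.3] -/
def IsDistNPComplete (Q : DistProblem) : Prop :=
  Q ∈ DistNP ∧ IsDistHard DistNP Q

/-! ### API -/

/-- A deterministic errorless heuristic scheme is a randomized one (use no coins,
`RandAlg.ofDet`): `AvgP ⊆ AvgBPP`. [Bogdanov–Trevisan 2006, §2.3 (after Def. 2.11)] [cite: BogdanovTrevisan2006, §2.3 (after Def. 2.11] -/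
def AvgP_subset_AvgBPP : Prop :=
  AvgP ⊆ AvgBPP

/-- A deterministic heuristic scheme is a randomized one: `HeurP ⊆ HeurBPP`.
[Bogdanov–Trevisan 2006, §2.3 (after Def. 2.13)] [cite: BogdanovTrevisan2006, §2.3 (after Def. 2.13] -/
def HeurP_subset_HeurBPP : Prop :=
  HeurP ⊆ HeurBPP

/-- Randomized errorless heuristic schemes are randomized heuristic schemes (answer `0` instead
of `⊥`; on a good input the error probability stays `≤ 1/4 + Pr[⊥]`, then amplify):
`AvgBPP ⊆ HeurBPP`. [Bogdanov–Trevisan 2006, §2.3] [cite: BogdanovTrevisan2006, §2.3] -/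
def AvgBPP_subset_HeurBPP : Prop :=
  AvgBPP ⊆ HeurBPP

/-- Heuristic polynomial-time reducibility is reflexive (`f(x; n) = x`, `m = X`, `p = 1`).
[Bogdanov–Trevisan 2006, §3.1] [cite: BogdanovTrevisan2006, §3.1] -/
protected def DistProblem.PolyTimeReducible.refl : Prop :=
  ∀ (Q : DistProblem),
    Q.PolyTimeReducible Q

/-- Heuristic polynomial-time reducibility is transitive: compose the maps as
`x ↦ f₂(f₁(x; n); m₁(n))` (polynomial time since `m₁` is a polynomial), with parameter map
`m₂ ∘ m₁` (`Polynomial.comp`) and domination factor `p₁ · (p₂ ∘ m₁)`; correctness on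
`supp D₁,ₙ` transfers because domination gives `f₁(supp D₁,ₙ; n) ⊆ supp D₂,ₘ₁₍ₙ₎`.
[Bogdanov–Trevisan 2006, §3.1 (remark after Def. 3.1)] [cite: BogdanovTrevisan2006, §3.1 (remark after Def. 3.1] -/
def DistProblem.PolyTimeReducible.trans : Prop :=
  ∀ {Q₁ Q₂ Q₃ : DistProblem} (h₁₂ : Q₁.PolyTimeReducible Q₂) (h₂₃ : Q₂.PolyTimeReducible Q₃),
    Q₁.PolyTimeReducible Q₃

/-- `AvgP` is closed under heuristic polynomial-time reductions: if `Q₁ ≤ Q₂` and `Q₂ ∈ AvgP`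
then `Q₁ ∈ AvgP` (compute `m(n)` — a polynomial — and run the scheme for `Q₂` on `f(x; n)` with
parameter `m(n)` and failure parameter `m' = m · p(n)`; domination transfers the failure
probability).
[Bogdanov–Trevisan 2006, Lemma 3.2; Levin 1986] [cite: BogdanovTrevisan2006, Lemma 3.2] -/
def mem_AvgP_of_polyTimeReducible : Prop :=
  ∀ {Q₁ Q₂ : DistProblem} (h : Q₁.PolyTimeReducible Q₂) (h₂ : Q₂ ∈ AvgP),
    Q₁ ∈ AvgP

/-- `HeurBPP` is closed under heuristic polynomial-time reductions (same proof as for `AvgP`: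
run the randomized scheme for `Q₂` on `(f(x; n), 1^{m(n)}, 1^{m'·p(n)})`; the set of bad inputs
transfers along the domination bound).
[Bogdanov–Trevisan 2006, Lemma 3.2 (and the remark that the proof applies to all the
heuristic classes of Ch. 2)] [cite: BogdanovTrevisan2006, Lemma 3.2 (and the remark that the proof] -/
def mem_HeurBPP_of_polyTimeReducible : Prop :=
  ∀ {Q₁ Q₂ : DistProblem} (h : Q₁.PolyTimeReducible Q₂) (h₂ : Q₂ ∈ HeurBPP),
    Q₁ ∈ HeurBPP

/-- Existence of `DistNP`-complete problems: there is a distributional problem in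
`(NP, PSamp)` to which every problem of `DistNP` reduces under (deterministic) heuristic
polynomial-time reductions. Proof in print: take nondeterministic bounded halting `BH` with the
*universal samplable ensemble* — at parameter `N = ⟨n, t⟩` (Cantor pairing) pick an index `k`
(a pair: nondeterministic machine, probabilistic sampler) with dyadic weight `2^{-(2|k|+1)}`,
run the sampler on `1ⁿ` clocked to `t` steps obtaining `x`, and output the instance
`⟨k, x, 1^{t}⟩`; this ensemble is exactly polynomial-time samplable (matching C11's exact
`IsPolySamplable`), `BH ∈ NP`, and a problem `(L, D) ∈ (NP, PSamp)` with index `k₀` reduces via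
`f(x; n) = ⟨k₀, x, 1^{q(n)}⟩` with the polynomial parameter map `m(n) = ⟨n, q(n)⟩` and constant
domination factor `2^{2|k₀|+1}`; correctness is needed only for `x ∈ supp Dₙ`, where
`|x| ≤ poly(n)` (`IsPolySamplable.hasPolyLength`) so that the clock `q(n)` suffices for the
`NP`-verifier (Levin 1986 for P-computable ensembles;
Ben-David–Chor–Goldreich–Luby 1992, §3, universal distributions; Bogdanov–Trevisan 2006,
Thm. 3.3 and the introduction of Ch. 5). Note: the stronger statement that a problem with the
*uniform* ensemble is complete for `(NP, PSamp)` (Impagliazzo–Levin 1990; Bogdanov–Trevisan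
Ch. 5) uses *randomized* heuristic reductions and is **not** what is asserted here.
[Levin 1986; Ben-David–Chor–Goldreich–Luby 1992, §3; Bogdanov–Trevisan 2006, Thm. 3.3, Ch. 5]
[cite: Levin1986] -/
def exists_isDistNPComplete : Prop :=
  ∃ Q, IsDistNPComplete Q

/-- Worst-case probabilistic polynomial time is heuristic probabilistic polynomial time for
every ensemble: `(BPP, 𝒟) ⊆ HeurBPP` (amplify a `BPP` machine to error `≤ 1/4` on every input
and ignore `1ⁿ, 1ᵐ`; then no input is bad). Stated for all ensembles, strengthening the
outline's uniform-ensemble version. [Bogdanov–Trevisan 2006, §2.3] [cite: BogdanovTrevisan2006, §2.3] -/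
def distClass_BPP_subset_HeurBPP : Prop :=
  distClass BPP Set.univ ⊆ HeurBPP

/-- **Dropping the scheme parameters is polynomial time** (the machine content of
`distClass_BPP_subset_HeurBPP`, and of `distClass_P_subset_AvgP`-type inclusions): the map
`(⟨x, ⟨1ⁿ, 1ᵐ⟩⟩, r) ↦ (x, r)`, read from the scheme encoding `boolPair (schemeEnc (x, n, m)) r` and
written as `boolPair x r`, is polynomial-time computable — undo the outer doubling of `x`, skip
the unary parameters up to the separator, keep the coin string `r` (linear time; cf. the
projection machine `boolUnpairFstLift` of `NondeterministicProofs.lean`). It turns a randomized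
worst-case algorithm on `x` (`RandAlg.IsPolyTime id`) into one on scheme inputs
(`RandAlg.IsPolyTime schemeEnc`) that ignores `1ⁿ, 1ᵐ`, via `PolyTimeComputable.comp`.
A routine machine construction, not in Mathlib.
[Arora–Barak 2009, §0.1 (pairing) and §1.2; Bogdanov–Trevisan 2006, §2.3 (inputs `(x; n, δ)`)]
[cite: AroraBarak2009, §0.1 and §1.2] -/
def polyTimeComputable_schemeEnc_dropParams : Prop :=
  PolyTimeComputable (fun p : (List Bool × ℕ × ℕ) × List Bool => boolPair (schemeEnc p.1) p.2)
    (Function.uncurry boolPair) fun p : (List Bool × ℕ × ℕ) × List Bool => (p.1.1, p.2)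

end Literature.Computability.MetaComplexity
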